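import Mathlib.Geometry.Manifold.Instances.Sphere
import Mathlib.Geometry.Manifold.SmoothEmbedding
import Mathlib.Geometry.Manifold.Diffeomorph
import Mathlib.Geometry.Manifold.MFDeriv.Basic
import Mathlib.Topology.Homotopy.Equiv
import Literature.Topology.FourManifolds.Knots
import Literature.Topology.FourManifolds.SliceRibbon
import HarnessLib

/-!
# Knots that are slice in a homotopy 4-ball

Topic `Literature/Topology/FourManifolds` (definition item `defn-Knot.IsHomotopyBallSlice`, route
`SmoothPoincare4/ZeroSurgeryExotic`).

A knot `K ⊂ S³` is **slice in a homotopy 4-ball** if it bounds a smoothly, properly embedded disc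
in some compact contractible smooth 4-manifold `W` with `∂W = S³` — equivalently
(`W = Σ ∖ B̊⁴`, `Σ = W ∪ B⁴`) if it bounds a smooth proper disc in `Σ° := Σ ∖ B̊⁴` for some
homotopy 4-sphere `Σ` (Freedman–Gompf–Morrison–Walker 2010, §1; Manolescu–Piccirillo 2023, §1:
"a knot `K` which bounds a smoothly embedded disk in `W ∖ B̊⁴`" for a homotopy sphere `W`, and
Def. 2.1 with `[Δ] = 0` automatic). If such a `K` is not slice in `B⁴`, then `Σ` is an exotic
4-sphere; this is the FGMW / Manolescu–Piccirillo strategy against SPC4.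

We follow the conventions of `SliceRibbon.lean` (`Literature.Topology.FourManifolds.Knot.IsSliceDisc`): the ambient manifold is
boundaryless and the disc is the restriction to the closed unit disc `𝔻² ⊂ ℝ²` of a smooth map
defined on all of `ℝ²`; the removed ball is the image of the closed unit ball under a smooth
embedding `e : ℝ⁴ ↪ Σ` (an open chart), so that `∂Σ° = e(S³)` and `K` sits in it as `e ∘ K`.

* `Literature.Knot.IsSliceDiscIn K X e f` — `f|_{𝔻²}` is a smooth proper slice disc for `K` in
  `X° = X ∖ e(B̊⁴)`: `e : ℝ⁴ → X` is a smooth embedding, `f : ℝ² → X` is `C^∞`, an injective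
  immersion on `𝔻²`, sends the open disc into `X ∖ e(𝔻⁴)` (properness: interior to interior)
  and restricts to `e ∘ K` on `S¹ = ∂𝔻²`.
* `Literature.Knot.IsHomotopyBallSlice K` — there are a closed smooth 4-manifold `Σ` homotopy
  equivalent to `S⁴` and `e, f` with `K.IsSliceDiscIn Σ e f`.
* API: projections, and `IsHomotopyBallSlice.mono`-type restatement `isHomotopyBallSlice_iff`.
* Named facts (statements only, D-0014): `IsSmoothlySlice.isHomotopyBallSlice` (slice in `B⁴`
  ⇒ slice in every `X°`, in particular in `S⁴ ∖ B̊⁴ = B⁴`; MP 2023, after Def. 2.1) and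
  `exists_exotic_of_isHomotopyBallSlice_not_isSmoothlySlice` (the FGMW lemma: a knot slice in a
  homotopy ball but not in `B⁴` yields a homotopy 4-sphere not diffeomorphic to `S⁴`; FGMW 2010,
  §1 — via Palais' disc theorem `S⁴ ∖ e(B̊⁴) ≅ B⁴`).

## Design choices

* No manifolds with boundary: `W` is presented as `Σ ∖ e(B̊⁴)`; this is the form in which both
  sources phrase it and it reuses the `IsSliceDisc` technology verbatim (`ContMDiff`/`mfderiv`
  replace `ContDiff`/`fderiv` since the target is an abstract manifold).
* Neatness (transversality to `∂Σ°`) is **not** required, unlike `IsSliceDisc` (where it serves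
  the ribbon condition): any proper smooth disc is isotopic rel boundary to a neat one.
* The quantifier over *all* ball embeddings `e` (both orientations) is harmless here: `Σ` ranges
  over all homotopy spheres, a class closed under orientation reversal, and `B⁴`-sliceness is
  mirror-invariant. (For a fixed chiral `X` the analogous "`∃ e`" notion would mean "slice in `X`
  or in `X̄`"; we therefore do not introduce a general `IsSliceIn X`.)
* Homotopy 4-spheres are presented unbundled, exactly as in `SmoothPoincareConjectureFour` /
  `ExistsExoticFourSphere` (`Type`-valued existential, `T2Space`, `SecondCountableTopology`,
  `ChartedSpace (𝔼 4)`, `IsManifold (𝓡 4) ∞`, `CompactSpace`, `Nonempty (M ≃ₕ 𝕊 4)`), not via the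
  oriented bundled `Literature.Topology.FourManifolds.HomotopySphere` (no orientation is wanted).
* Mathlib has spheres, smooth embeddings, `mfderiv`, homotopy equivalences; no slice knots
  (those are the library's `Literature.Topology.FourManifolds.Knot.IsSliceDisc`/`IsSmoothlySlice`), searched `slice`, `Slice`.

## References

* M. Freedman, R. Gompf, S. Morrison, K. Walker, *Man and machine thinking about the smooth
  4-dimensional Poincaré conjecture*, Quantum Topol. 1 (2010) 171–208, §1.
* C. Manolescu, L. Piccirillo, *From zero surgeries to candidates for exotic definite
  4-manifolds*, J. Lond. Math. Soc. 108 (2023) 2001–2036 (arXiv:2102.04391), §1 and Def. 2.1.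
* R. Palais, *Extending diffeomorphisms*, Proc. AMS 11 (1960) 274–277 (uniqueness of smooth
  ball embeddings up to ambient isotopy).
* R. H. Fox, *A quick trip through knot theory* (1962), §7.
-/

open scoped Manifold ContDiff Topology
open Function Set ContinuousMap

noncomputable section

namespace Literature.Topology.FourManifolds

/-- Local notation: `𝔼 n` is the model Euclidean space `EuclideanSpace ℝ (Fin n)`. -/
local notation "𝔼 " n:arg => EuclideanSpace ℝ (Fin n)

/-- Local notation: `𝕊 n` is the unit sphere in `EuclideanSpace ℝ (Fin (n + 1))`. -/
local notation "𝕊 " n:arg => (Metric.sphere (0 : EuclideanSpace ℝ (Fin (n + 1))) 1)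

/-- Local notation: `𝔻²` is the closed unit disc in `ℝ²`. -/
local notation "𝔻²" => Metric.closedBall (0 : EuclideanSpace ℝ (Fin 2)) 1

namespace Knot

/-- **Slice disc in a punctured 4-manifold.** For a knot `K : S¹ ↪ S³`, a charted space `X`
modelled on `ℝ⁴`, a map `e : ℝ⁴ → X` and a map `f : ℝ² → X`: `IsSliceDiscIn K X e f` says that
`e` is a smooth embedding (so `e(𝔻⁴)` is a smooth closed 4-ball in `X` and `X° := X ∖ e(B̊⁴)` a
smooth 4-manifold with boundary `e(S³)`), and `f` restricted to the closed unit disc `𝔻²` is a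
smooth, properly embedded disc in `X°` bounded by `K ⊂ S³ = ∂X°`: `f` is `C^∞`, injective and
immersive on `𝔻²`, maps the open disc into `X ∖ e(𝔻⁴)` and satisfies `f = e ∘ K` on `S¹ = ∂𝔻²`.
For `X = S⁴` and `e` a hemisphere chart this is a slice disc in `B⁴` in the usual sense.
[cite: ManolescuPiccirillo2023, §1 and Def. 2.1] -/
def IsSliceDiscIn (K : Knot) (X : Type*) [TopologicalSpace X] [ChartedSpace (𝔼 4) X]
    (e : 𝔼 4 → X) (f : 𝔼 2 → X) : Prop :=
  Manifold.IsSmoothEmbedding (𝓡 4) (𝓡 4) ∞ e ∧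
    ContMDiff (𝓡 2) (𝓡 4) ∞ f ∧ InjOn f 𝔻² ∧
    (∀ x ∈ 𝔻², Injective (mfderiv (𝓡 2) (𝓡 4) f x)) ∧
    (∀ x : 𝔼 2, ‖x‖ < 1 → f x ∉ e '' Metric.closedBall (0 : 𝔼 4) 1) ∧
    ∀ x : 𝕊 1, f x = e (K x)

/-- **Slice in a homotopy 4-ball** ("H-slice in a homotopy sphere"). The knot `K` bounds a
smooth properly embedded disc in `Σ° = Σ ∖ B̊⁴` for some closed smooth 4-manifold `Σ` (Hausdorff,
second countable, compact, model `ℝ⁴`) homotopy equivalent to `S⁴`; equivalently, `K` is slice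
in some compact contractible smooth 4-manifold `W` with `∂W = S³` (`W = Σ°`, `Σ = W ∪_{S³} B⁴`).
Every slice knot is slice in a homotopy ball (`IsSmoothlySlice.isHomotopyBallSlice`); a knot
that is slice in a homotopy ball but not slice would disprove SPC4
(`exists_exotic_of_isHomotopyBallSlice_not_isSmoothlySlice`).
[cite: FreedmanGompfMorrisonWalker2010, §1] -/
def IsHomotopyBallSlice (K : Knot) : Prop :=
  ∃ (M : Type) (_ : TopologicalSpace M) (_ : T2Space M) (_ : SecondCountableTopology M)
    (_ : ChartedSpace (𝔼 4) M) (_ : IsManifold (𝓡 4) ∞ M) (_ : CompactSpace M),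
    Nonempty (M ≃ₕ 𝕊 4) ∧ ∃ (e : 𝔼 4 → M) (f : 𝔼 2 → M), K.IsSliceDiscIn M e f

/-! ### Basic API -/

variable {K : Knot} {X : Type*} [TopologicalSpace X] [ChartedSpace (𝔼 4) X] {e : 𝔼 4 → X}
  {f : 𝔼 2 → X}

/-- The ball of a slice disc datum is smoothly embedded. [cite: ManolescuPiccirillo2023, Def. 2.1] -/
theorem IsSliceDiscIn.isSmoothEmbedding (h : K.IsSliceDiscIn X e f) :
    Manifold.IsSmoothEmbedding (𝓡 4) (𝓡 4) ∞ e :=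
  h.1

/-- A slice disc is smooth. [cite: ManolescuPiccirillo2023, Def. 2.1] -/
theorem IsSliceDiscIn.contMDiff (h : K.IsSliceDiscIn X e f) : ContMDiff (𝓡 2) (𝓡 4) ∞ f :=
  h.2.1

/-- A slice disc is injective on the closed disc. [cite: ManolescuPiccirillo2023, Def. 2.1] -/
theorem IsSliceDiscIn.injOn (h : K.IsSliceDiscIn X e f) : InjOn f 𝔻² :=
  h.2.2.1

/-- A slice disc restricts to (the image under `e` of) the knot on the boundary circle.
[cite: ManolescuPiccirillo2023, Def. 2.1] -/
theorem IsSliceDiscIn.apply_sphere (h : K.IsSliceDiscIn X e f) (x : 𝕊 1) : f x = e (K x) :=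
  h.2.2.2.2.2 x

/-- Properness: the open disc misses the removed closed ball `e(𝔻⁴)`.
[cite: ManolescuPiccirillo2023, Def. 2.1] -/
theorem IsSliceDiscIn.apply_notMem (h : K.IsSliceDiscIn X e f) {x : 𝔼 2} (hx : ‖x‖ < 1) :
    f x ∉ e '' Metric.closedBall (0 : 𝔼 4) 1 :=
  h.2.2.2.2.1 x hx

/-- The boundary circle of a slice disc lies on the boundary sphere `e(S³)` of `X°`.
[cite: ManolescuPiccirillo2023, Def. 2.1] -/
theorem IsSliceDiscIn.apply_sphere_mem (h : K.IsSliceDiscIn X e f) (x : 𝕊 1) :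
    f x ∈ e '' Metric.sphere (0 : 𝔼 4) 1 :=
  ⟨K x, (K x).2, (h.apply_sphere x).symm⟩

/-- Constructor for `IsHomotopyBallSlice` from a slice disc in a given homotopy 4-sphere.
[cite: FreedmanGompfMorrisonWalker2010, §1] -/
theorem IsSliceDiscIn.isHomotopyBallSlice {M : Type} [TopologicalSpace M] [T2Space M]
    [SecondCountableTopology M] [ChartedSpace (𝔼 4) M] [IsManifold (𝓡 4) ∞ M] [CompactSpace M]
    (hM : Nonempty (M ≃ₕ 𝕊 4)) {e : 𝔼 4 → M} {f : 𝔼 2 → M} (h : K.IsSliceDiscIn M e f) :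
    K.IsHomotopyBallSlice :=
  ⟨M, _, ‹_›, ‹_›, _, ‹_›, ‹_›, hM, e, f, h⟩

/-! ### Named facts (statements; D-0014) -/

/-- **Slice knots are slice in every homotopy ball**, in particular `IsSmoothlySlice K →
IsHomotopyBallSlice K` (take `Σ = S⁴`, `e` the lower-hemisphere chart with `e(𝔻⁴)` the closed
lower hemisphere, and push a slice disc in `B⁴ ≅` upper hemisphere). Manolescu–Piccirillo:
"if a knot is slice in the usual sense, then it is H-slice in any `W`".
[cite: ManolescuPiccirillo2023, §2 (after Def. 2.1)] -/
def IsSmoothlySlice.isHomotopyBallSlice : Prop :=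
  ∀ K : Knot, K.IsSmoothlySlice → K.IsHomotopyBallSlice

/-- **The FGMW lemma** (Freedman–Gompf–Morrison–Walker strategy). If some knot is slice in a
homotopy 4-ball but not slice in `B⁴`, then there is an exotic 4-sphere: a closed smooth
4-manifold homotopy equivalent but not diffeomorphic to `S⁴` (namely the `Σ` carrying the disc:
were `Σ ≅ S⁴`, then `Σ ∖ e(B̊⁴) ≅ B⁴` by Palais' disc theorem and the disc would be a slice disc
in `B⁴`). Contrapositive form of "SPC4 ⇒ every homotopy-ball-slice knot is slice".
[cite: FreedmanGompfMorrisonWalker2010, §1] -/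
def exists_exotic_of_isHomotopyBallSlice_not_isSmoothlySlice : Prop :=
  (∃ K : Knot, K.IsHomotopyBallSlice ∧ ¬ K.IsSmoothlySlice) →
    ∃ (M : Type) (_ : TopologicalSpace M) (_ : T2Space M) (_ : SecondCountableTopology M)
      (_ : ChartedSpace (𝔼 4) M) (_ : IsManifold (𝓡 4) ∞ M) (_ : CompactSpace M),
      Nonempty (M ≃ₕ 𝕊 4) ∧ IsEmpty (M ≃ₘ⟮𝓡 4, 𝓡 4⟯ 𝕊 4)

end Knot

end Literature.Topology.FourManifolds

end
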